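import Mathlib
import HarnessLib

/-!
# Route `KLProgramme` — crux K3 ENGINE (stmt-HubbardSuperconductivity-20437 `KLRegimeEngineV17F2`), stub (b) v2, THE LEVELS PACKAGE (ℓ), (I5)/(I3) bridge:
# A GRID-SHAPED BASE BOUND `A_g·(p̂·u)^m` IS A B-DISCOUNTED LAW-SHAPED PROFILE `(a₁/B²)·λ^{m−1}·q₀^m` once `B·K·u ≤ λ`
# (cell gate-hubbard-kl, seat hubbard-kl-k3c3-p2 g14; the arithmetic between k3c2-p3's base rows (p668143/p670020: `klTowerMuLev[F]_le_profile_of_wtPinned`,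
#  `gridLaw_div_klLevUnit[F]_le`) and the `hbase` hypothesis of `towerBorn_le_law_tracks_of_rows` (p670524) / the (I5)-LEV-G numerics (p669268))

WHY.  The re-based tower's block-0 datum (the base `𝒱_d` read at `F_{d−1}` from p3's weighted grid step) is delivered GRID-SHAPED: `μ 0 m ≤ A_g·P^m` with NO `λ^{m−1}`
structure — the coupling sits inside `P = p̂·|U|` (one `f₂ ∝ |U|` per vertex) — or, in k3c2-p3's law form, `(2^{7J}A·λ′)·λ′^{m−1}·(P/(8^Jλ′))^m` with an AMPLITUDE
`∝ λ′` and a BASE `∝ 1/λ′`, which the (I5) numerics cannot take (their `A′, Q′` must be λ-free; `Q_b ∝ 1/λ` is unbounded).  The (I5)-compatible reading extracts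
`λ^{m−1}` from `|U|^{m−1}` through the kit's coupling `λ = B·ε ≥ B·Klam·|U|`: for `m ≥ 3` and `B·K ≥ 1`,
`A_g·(p̂·u)^m = A_g·u·p̂^m·u^{m−1} ≤ A_g·u·p̂^m·(λ/(BK))^{m−1} ≤ (A_g·u/(B·K)²)·λ^{m−1}·p̂^m` — a law-shaped profile with the B-DISCOUNTED amplitude
`a₁ = A_g·u/K²·B⁻²` (E1-TOWER-BLOCKED §9 (ii)) and the λ-FREE base `q₀ = p̂`, exactly the `hbase` shape of `towerBorn_le_law_tracks_of_rows` / `towerLevNumericsG_*`.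

* `pow_div_le_inv_sq` — `(λ/(BK))^{m−1}·… `: `(BK)^{−(m−1)} ≤ (BK)^{−2}` for `m ≥ 3`, `BK ≥ 1`;
* **`gridBase_le_disc_law`** — the displayed inequality; **`gridBase_profile_disc`** — the `∀ m, 3 ≤ m → m ≤ D` profile form for an array `μ0`.
Pure real arithmetic; nothing about the model is asserted; nothing asserts (ℓ), any stub, K3 or superconductivity.
References: BGM 2006 §2.8 (2.93)–(2.98) [cite: BenfattoGiulianiMastropietro2006].
-/

noncomputable section

namespace Summit.HubbardSuperconductivity.HubbardSuperconductivity.Theorems.EngineV8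

set_option linter.dupNamespace false -- summit = problem name (single-conjunct summit), D-0017

/-- `u^{m−1} ≤ u·… `: for `0 ≤ u`, `B·K·u ≤ λ`, `1 ≤ B·K`, `3 ≤ m`: `u^{m−1} ≤ λ^{m−1}/(B·K)²`. [folklore] -/
theorem pow_le_pow_div_sq {u lam BK : ℝ} (hu : 0 ≤ u) (hBK : 1 ≤ BK) (hle : BK * u ≤ lam) {m : ℕ} (hm : 3 ≤ m) :
    u ^ (m - 1) ≤ lam ^ (m - 1) / BK ^ 2 := by
  have hBK0 : 0 < BK := lt_of_lt_of_le one_pos hBK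
  have hul : u ≤ lam / BK := by rw [le_div_iff₀ hBK0, mul_comm]; exact hle
  have hlam : 0 ≤ lam := le_trans (by positivity) hle
  calc u ^ (m - 1) ≤ (lam / BK) ^ (m - 1) := pow_le_pow_left₀ hu hul _
    _ = lam ^ (m - 1) / BK ^ (m - 1) := by rw [div_pow]
    _ ≤ lam ^ (m - 1) / BK ^ 2 := div_le_div_of_nonneg_left (pow_nonneg hlam _) (pow_pos hBK0 2) (pow_le_pow_right₀ hBK (by omega))

/-- **A grid-shaped base bound is a B-discounted law-shaped profile**: for `A_g, p̂, u ≥ 0`, `1 ≤ B·K`, `B·K·u ≤ λ`, `3 ≤ m`,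
`A_g·(p̂·u)^m ≤ (A_g·u/(B·K)²)·λ^{m−1}·p̂^m`. [cite: BenfattoGiulianiMastropietro2006, §2.8 (2.93)-(2.98)] -/
theorem gridBase_le_disc_law {Ag ph u lam BK : ℝ} (hAg : 0 ≤ Ag) (hph : 0 ≤ ph) (hu : 0 ≤ u) (hBK : 1 ≤ BK) (hle : BK * u ≤ lam) {m : ℕ} (hm : 3 ≤ m) :
    Ag * (ph * u) ^ m ≤ (Ag * u / BK ^ 2) * lam ^ (m - 1) * ph ^ m := by
  have hBK0 : 0 < BK := lt_of_lt_of_le one_pos hBK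
  have hpow := pow_le_pow_div_sq hu hBK hle hm
  obtain ⟨n, rfl⟩ : ∃ n, m = n + 1 := ⟨m - 1, by omega⟩
  rw [Nat.add_sub_cancel] at hpow ⊢
  have hphn : 0 ≤ ph ^ (n + 1) := pow_nonneg hph _
  calc Ag * (ph * u) ^ (n + 1) = Ag * ph ^ (n + 1) * u * u ^ n := by rw [mul_pow, pow_succ]; ring
    _ ≤ Ag * ph ^ (n + 1) * u * (lam ^ n / BK ^ 2) := mul_le_mul_of_nonneg_left hpow (by positivity)
    _ = (Ag * u / BK ^ 2) * lam ^ n * ph ^ (n + 1) := by field_simp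

/-- **Profile form**: an array with a grid-shaped bound `μ0 m ≤ A_g·(p̂·u)^m` (`3 ≤ m ≤ D`) obeys the `hbase` shape of `towerBorn_le_law_tracks_of_rows`,
`μ0 m ≤ a₁·λ^{m−1}·q₀^m` with `a₁ := A_g·u/(B·K)²`, `q₀ := p̂`, once `B·K·u ≤ λ`, `1 ≤ B·K`. -/
theorem gridBase_profile_disc {μ0 : ℕ → ℝ} {Ag ph u lam BK : ℝ} {D : ℕ} (hAg : 0 ≤ Ag) (hph : 0 ≤ ph) (hu : 0 ≤ u) (hBK : 1 ≤ BK) (hle : BK * u ≤ lam)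
    (hμ0 : ∀ m, 3 ≤ m → m ≤ D → μ0 m ≤ Ag * (ph * u) ^ m) :
    ∀ m, 3 ≤ m → m ≤ D → μ0 m ≤ (Ag * u / BK ^ 2) * lam ^ (m - 1) * ph ^ m := fun m hm hmD =>
  (hμ0 m hm hmD).trans (gridBase_le_disc_law hAg hph hu hBK hle hm)

end Summit.HubbardSuperconductivity.HubbardSuperconductivity.Theorems.EngineV8

end
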